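import Summits.SmoothPoincare4.SmoothPoincare4.Theorems.SymplecticOrigamiGromovRecognitionRelEndGlueDefs
import Literature.Geometry.Symplectic.JSphereLocalFoliation

/-!
# Two leaves of one family are equal or disjoint
(registered helper `helper_leaf_disjoint` of line `cross-cap-laurent`, crux
`GromovRecognitionRelEnd`, item stmt-SmoothPoincare4-11009; integration lemma L4 of the glue of the
bi-foliation)

Setting: `(X, JX)` a compact almost complex 4-manifold, `F₀ : C(ℂℙ¹, X)` a reference glued map, and
two LEAVES `(u, v)`, `(u', v')` of the family of `F₀` (`IsLeafOf`: embedded `JX`-holomorphic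
two-chart spheres with a trivial-normal-bundle witness whose glued maps `F`, `F'` are homotopic to
`F₀`).  Claim: the images `pairImage u v = range u ∪ {v 0}` and `pairImage u' v'` are equal or
disjoint.

Proof: the local foliation fact `hls_localFoliation_embeddedSphere_trivialNormal` (a HYPOTHESIS),
applied to the first leaf and its normal witness, gives a family of pairwise disjoint leaves
`Λ a = range (U a) ∪ {V a 0}`, `‖a‖ < ε`, with `Λ 0 = pairImage u v`, sweeping out an OPEN set
`W`, together with the uniqueness clause: a `JX`-two-chart sphere whose glued map is homotopic to
the glued map `F` of `(u, v)` and which has an affine point `u' z ∈ Λ a` for some `‖a‖ < ε` has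
image `Λ a'` for some `‖a'‖ < ε`.  If the two images share a point `y`, then some affine point
`u' z` lies in `W ⊇ Λ 0 ∋ y`: either `y = u' z` itself, or `y = v' 0 = lim_{w → 0} v' w` with
`v' w = u' w⁻¹` for `w ≠ 0`, and `W` is an open neighbourhood of `y`.  As `F' ∼ F₀ ∼ F`, the
uniqueness clause gives `pairImage u' v' = Λ a'`; since `y ∈ Λ a' ∩ Λ 0` and distinct leaves are
disjoint, `a' = 0`, so the images agree.

References: C. Wendl, *Holomorphic Curves in Low Dimensions*, LNM 2216 (2018), Prop. 2.53 and
Thm. 2.49; H. Hofer, V. Lizan, J.-C. Sikorav, J. Geom. Anal. 7 (1997), Thm. 1.  No new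
definitions, notation or instances.
-/

noncomputable section

open scoped Manifold ContDiff Topology
open Set Function Filter Literature.Topology.FourManifolds Literature.Topology.FourManifolds.ComplexProjectiveSpace
  Literature.Geometry.Symplectic

-- the prescribed namespace `Summit.<P>.<Sub>.…` duplicates `SmoothPoincare4` (P = Sub)
set_option linter.dupNamespace false

namespace Summit.SmoothPoincare4.SmoothPoincare4.Theorems.GromovRecognitionRelEnd.CrossCapLaurent

/-- **L4 (registered helper `helper_leaf_disjoint`): two leaves of one family are equal (as point
sets) or disjoint.**  For two leaves `(u, v)`, `(u', v')` of the family of `F₀`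
(`IsLeafOf (fun y => JX y) F₀`), the images `pairImage u v` and `pairImage u' v'` are equal or
disjoint: the uniqueness clause of the local foliation fact
`hls_localFoliation_embeddedSphere_trivialNormal` (a hypothesis) around the first leaf, combined
with the disjointness of the distinct leaves of that local family. -/
theorem helper_leaf_disjoint : ∀ (X : Type) [TopologicalSpace X] [T2Space X]
    [SecondCountableTopology X] [CompactSpace X] [ConnectedSpace X]
    [ChartedSpace (EuclideanSpace ℝ (Fin 4)) X] [IsManifold (𝓡 4) ∞ X]
    (JX : AlmostComplexStructure (𝓡 4) ∞ X) (F₀ : C(ComplexProjectiveSpace 1, X)),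
    hls_localFoliation_embeddedSphere_trivialNormal →
    ∀ (u v u' v' : ℂ → X), IsLeafOf (fun y => JX y) F₀ u v → IsLeafOf (fun y => JX y) F₀ u' v' →
    pairImage u v = pairImage u' v' ∨ Disjoint (pairImage u v) (pairImage u' v') := by
  intro X _ _ _ _ _ _ _ JX F₀ hF1 u v u' v' h h'
  obtain ⟨hS, hE, ⟨N, P, hN⟩, ⟨F, hF, hFF₀⟩⟩ := h
  obtain ⟨hS', -, -, ⟨F', hF', hF'F₀⟩⟩ := h'
  -- the local foliation around the first leaf
  obtain ⟨ε, U, V, hε, hU0, hV0, -, -, -, hdisj, -, hopen, huniq⟩ :=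
    hF1 X JX u v N P hS.smooth_u hS.smooth_v hS.compat hS.hol_u hS.hol_v hE.injective hE.imm_u
      hE.imm_v hE.infty_notMem hN.isOpen hN.image_subset hN.smooth hN.submersive hN.zeroSet_eq
  -- the leaf `a = 0` is the image of `(u, v)`
  have hleaf0 : range (U 0) ∪ {V 0 0} = pairImage u v := by
    rw [pairImage_eq, (funext hU0 : U 0 = u), hV0]
  have hε0 : ‖(0 : ℂ)‖ < ε := by simpa using hε
  -- the swept open set contains the image of `(u, v)`
  set W : Set X := ⋃ a ∈ Metric.ball (0 : ℂ) ε, (range (U a) ∪ {V a 0})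
  have hW0 : pairImage u v ⊆ W :=
    hleaf0 ▸ subset_biUnion_of_mem (u := fun a => range (U a) ∪ {V a 0}) (Metric.mem_ball_self hε)
  by_cases hd : Disjoint (pairImage u v) (pairImage u' v')
  · exact Or.inr hd
  left
  obtain ⟨y, hy, hy'⟩ := Set.not_disjoint_iff.1 hd
  -- some affine point `u' z` of the second leaf lies in the swept set
  have hz : ∃ z, u' z ∈ W := by
    rcases (mem_pairImage_iff u' v' y).1 hy' with ⟨z, rfl⟩ | rfl
    · exact ⟨z, hW0 hy⟩
    · -- `v' 0 ∈ W` open and `v'` continuous: `v' w = u' w⁻¹ ∈ W` for some `w ≠ 0`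
      have hmem : ∀ᶠ w in 𝓝 (0 : ℂ), v' w ∈ W :=
        hS'.smooth_v.continuous.continuousAt.preimage_mem_nhds (hopen.mem_nhds (hW0 hy))
      obtain ⟨w, hw, hw0⟩ := ((eventually_nhdsWithin_of_eventually_nhds hmem).and
        (self_mem_nhdsWithin : {(0 : ℂ)}ᶜ ∈ 𝓝[≠] (0 : ℂ))).exists
      refine ⟨w⁻¹, ?_⟩
      rw [← hS'.compat w (Set.mem_compl_singleton_iff.1 hw0)]
      exact hw
  -- uniqueness: the second leaf is a leaf `a` of the local family
  obtain ⟨z, hzW⟩ := hz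
  have hza : ∃ z a, ‖a‖ < ε ∧ u' z ∈ range (U a) ∪ {V a 0} := by
    obtain ⟨a, ha, hza⟩ := Set.mem_iUnion₂.1 hzW
    exact ⟨z, a, mem_ball_zero_iff.1 ha, hza⟩
  obtain ⟨a, ha, himg⟩ := huniq u' v' F' F hS'.smooth_u hS'.smooth_v hS'.compat hS'.hol_u
    hS'.hol_v hF'.chart_zero hF'.chart_one hF.chart_zero hF.chart_one (hF'F₀.trans hFF₀.symm) hza
  rw [← pairImage_eq] at himg
  -- `y ∈ leaf a ∩ leaf 0`, so `a = 0` by disjointness of distinct leaves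
  by_cases ha0 : a = 0
  · subst ha0
    rw [himg, hleaf0]
  · exact (Set.disjoint_left.1 (hdisj a 0 ha hε0 ha0) (himg ▸ hy') (hleaf0.symm ▸ hy)).elim

end Summit.SmoothPoincare4.SmoothPoincare4.Theorems.GromovRecognitionRelEnd.CrossCapLaurent

end
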